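import Literature.NumberTheory.LFunctions.ChebyshevHalfLineBiasImprimitiveRiesz
import Literature.NumberTheory.LFunctions.ChebyshevHalfLineBiasOrderMProofs
import Literature.NumberTheory.LFunctions.ChebyshevHalfLineBiasThm8LimitsProofs
import Literature.NumberTheory.LFunctions.GRHCharacterPrimeSumsProofs
import Literature.NumberTheory.LFunctions.MertensFormula
import HarnessLib

/-!
# GRH-CONDITIONAL prime-power layer for Hayani 2025 Thm 1.4 (Mertens for `χ²`, the `k ≥ 3` tail, the Riesz bound) — RH-FREE literature; «nothing here bears on the truth of RH»
# From `Λ(n)χ(n)/(√n log n)` to `π_{1/2}(x, χ) = Σ_{p ≤ x} χ(p)/√p`: the prime powers `p^k`, `k ≥ 2`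

LINE 1 — LABEL: GRH-CONDITIONAL where marked (Mertens II for a non-principal `χ²`, the Riesz bound), RH-FREE
otherwise (combinatorics of prime powers, the `k ≥ 3` tail, Mertens II for the principal `χ²`). Second file of the
discharge of the GRH-CONDITIONAL named fact `Literature.NumberTheory.LFunctions.Hayani2025_thm1_4`
(`ChebyshevBiasNaturalDensity.lean`; M. Hayani, arXiv:2512.23302, Thm 1.4; RH literature-typing tranche 1 part 2,
descendant of Suzuki, Ramanujan J. 68 (2025) = arXiv:2411.07436). Nothing in this file is, or is worded as, progress
toward RH or GRH. Theorems + glue definitions only; no named facts.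

## What is here (all PROVED)

With `a_χ(n) = Λ(n)χ(n)/√n` (`halfCoeff`, the coefficients of the tree's `HalfLineRiesz.halfLineSum χ`) and
`a_χ(n)/log n` (`qCoeff`; `= χ(p)^k/(k p^{k/2})` at `n = p^k`, `primePowTerm`):

* `qCoeff_eq_add` — `a_χ(n)/log n = [n prime]χ(n)/√n + sqCoeff(n) + highCoeff(n)` (prime squares / `k ≥ 3`),
  through the reindexing of prime powers `≤ N` as pairs `(p, k)`, `k ≤ log_p N`.
* `highPart_pointwise` (RH-FREE) — `‖Σ_{n ≤ u} highCoeff χ n − C₃‖ ≤ K/log u` for `u ≥ 3`: the pairs with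
  `p^k > u` have `k log p > log u`, so the tail is `≤ (Σ_{p, k ≥ 3} log p · p^{-k/2})/log u`, the weight being
  summable by `log p · p^{-k/2} ≤ 8√2 p^{-5/4} 2^{-k/2}`.
* `norm_sum_principal_div_prime_sub_le` (RH-FREE) — Mertens II for `χ₀ mod q`:
  `‖Σ_{p ≤ y} χ₀(p)/p − log log y − (B − Σ_{p ∣ q} 1/p)‖ ≤ 8/log y` (`y ≥ max(2, q)`), from the tree's
  `Mertens.abs_primeRecipSum_sub_le` (Hardy–Wright Thm 427).
* `exists_norm_sum_char_div_prime_sub_le` (GRH-CONDITIONAL) — for `ψ ≠ χ₀` with GRH: `Σ_{p ≤ N} ψ(p)/p = B_ψ +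
  O(1/log N)`, by Abel summation from `π(N, ψ) ≪ N^{5/8}` (the tree's MV Thm 13.7 (13.21),
  `GRHPrimeCharSum.exists_norm_primeSum_le_of_isPrimitive`, with `log(dN) ≤ 8(dN)^{1/8}`).
* `sqPart_pointwise` — `‖Σ_{n ≤ u} sqCoeff χ n − δ_χ log log u − β‖ ≤ K/log u` (`u ≥ u₀`), `δ_χ = ½[χ² = χ₀]`
  (`halfDelta`), assuming GRH for `χ²` when `χ² ≠ χ₀`.
* `exists_norm_halfLineSum_add_le_of_GRH_all` (GRH-CONDITIONAL) — for EVERY `χ ≠ χ₀` with GRH: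
  `‖f_χ(x) + c₀ log x + (m_χ/2) log²x‖ ≤ B` (`x > 1`), `m_χ = ord_{s=½} L(s, χ)`; the tree had the primitive cases
  and the imprimitive case with `L(½, χ) ≠ 0` — the imprimitive order-`m` case is closed here.

## References
* [Hayani2025] M. Hayani, *Chebyshev's bias without linear independence*, arXiv:2512.23302, Thm 1.4 and §3
  (proofs of Thms 1.3/1.4: Mertens' theorem for `χ(p²)/p`).
* [Suzuki2025Chebyshev] M. Suzuki, Ramanujan J. 68 (2025) 95 = arXiv:2411.07436, §4.1 (4.5), (4.5').
* [MontgomeryVaughan2007] H. L. Montgomery, R. C. Vaughan, *Multiplicative Number Theory I*, §13.1 Thm 13.7.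
* [HardyWright2008] G. H. Hardy, E. M. Wright, *An Introduction to the Theory of Numbers*, 6th ed., Thm 427.
-/

noncomputable section

open Real Filter Finset ArithmeticFunction

namespace Literature.NumberTheory.LFunctions

namespace Hayani2025Mean

/-! ## §1 Prime powers `≤ N` as pairs `(p, k)` -/

/-- Equal prime powers have equal primes. [folklore] -/
private theorem prime_eq_of_pow_eq {p p' k k' : ℕ} (hp : p.Prime) (hp' : p'.Prime) (hk : k ≠ 0)
    (h : p ^ k = p' ^ k') : p = p' := by
  have h1 : p ∣ p' ^ k' := h ▸ dvd_pow_self p hk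
  exact (Nat.prime_dvd_prime_iff_eq hp hp').1 (hp.dvd_of_dvd_pow h1)

/-- The prime powers in `[1, N]` are the `p^k`, `p ≤ N` prime, `1 ≤ k ≤ log_p N`. [folklore] -/
private theorem filter_isPrimePow_eq_biUnion (N : ℕ) :
    (Finset.Icc 1 N).filter IsPrimePow =
      ((Finset.Icc 1 N).filter Nat.Prime).biUnion fun p ↦ (Finset.Icc 1 (Nat.log p N)).image fun k ↦ p ^ k := by
  ext n
  simp only [Finset.mem_filter, Finset.mem_Icc, Finset.mem_biUnion, Finset.mem_image]
  constructor
  · rintro ⟨⟨hn1, hnN⟩, hpp⟩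
    obtain ⟨p, k, hp, hk, rfl⟩ := (isPrimePow_nat_iff _).1 hpp
    have hpN : p ≤ N := le_trans (Nat.le_self_pow (by omega) p) hnN
    exact ⟨p, ⟨⟨hp.one_lt.le, hpN⟩, hp⟩, k, ⟨hk, Nat.le_log_of_pow_le hp.one_lt hnN⟩, rfl⟩
  · rintro ⟨p, ⟨⟨-, hpN⟩, hp⟩, k, ⟨hk1, hkK⟩, rfl⟩
    have hN : N ≠ 0 := by
      rintro rfl
      rw [Nat.log_zero_right] at hkK
      omega
    have hk0 : k ≠ 0 := by omega
    exact ⟨⟨Nat.one_le_pow _ _ hp.pos, Nat.pow_le_of_le_log hN hkK⟩, hp.isPrimePow.pow hk0⟩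

/-- **Reindexing over prime powers**: `Σ_{n ≤ N, n prime power} g(n) = Σ_{p ≤ N prime} Σ_{1 ≤ k ≤ log_p N} g(p^k)`.
[folklore] -/
private theorem sum_filter_isPrimePow_eq (g : ℕ → ℂ) (N : ℕ) :
    ∑ n ∈ (Finset.Icc 1 N).filter IsPrimePow, g n =
      ∑ p ∈ (Finset.Icc 1 N).filter Nat.Prime, ∑ k ∈ Finset.Icc 1 (Nat.log p N), g (p ^ k) := by
  rw [filter_isPrimePow_eq_biUnion, Finset.sum_biUnion]
  · refine Finset.sum_congr rfl fun p hp ↦ ?_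
    have hpr : p.Prime := (Finset.mem_filter.1 hp).2
    rw [Finset.sum_image fun k _ k' _ h ↦ Nat.pow_right_injective hpr.two_le h]
  · intro p hp p' hp' hne
    simp only [Function.onFun]
    rw [Finset.disjoint_left]
    intro n hn hn'
    rw [Finset.mem_image] at hn hn'
    obtain ⟨k, hk, rfl⟩ := hn
    obtain ⟨k', -, h⟩ := hn'
    rw [Finset.mem_Icc] at hk
    have hpr : (p : ℕ).Prime := (Finset.mem_filter.1 (Finset.mem_coe.1 hp)).2
    have hpr' : (p' : ℕ).Prime := (Finset.mem_filter.1 (Finset.mem_coe.1 hp')).2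
    exact hne (prime_eq_of_pow_eq hpr hpr' (by omega) h.symm)

/-! ## §2 The coefficients `Λ(n)χ(n)/(√n log n)` split by the exponent of the prime power -/

variable {q : ℕ} (χ : DirichletCharacter ℂ q)

/-- The exponent `k` of a prime power `n = p^k` (`p = minFac n`); junk elsewhere. [folklore] -/
def expo (n : ℕ) : ℕ := n.factorization n.minFac

/-- `a_χ(n) = Λ(n)χ(n)/√n`, the coefficients of the tree's `halfLineSum χ` (Suzuki's `f_χ`). [folklore] -/
def halfCoeff (n : ℕ) : ℂ := (Λ n : ℂ) * χ n / (Real.sqrt n : ℂ)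

/-- `a_χ(n)/log n = Λ(n)χ(n)/(√n log n)` — the coefficients of `Σ_{p^k ≤ u} χ(p)^k/(k p^{k/2})`. [folklore] -/
def qCoeff (n : ℕ) : ℂ := halfCoeff χ n / (Real.log n : ℂ)

/-- `t_χ(p, k) = χ(p)^k/(k (√p)^k)`, the value of `a_χ(n)/log n` at `n = p^k`. [folklore] -/
def primePowTerm (p k : ℕ) : ℂ := χ p ^ k / ((k : ℂ) * (Real.sqrt p : ℂ) ^ k)

/-- The prime part: `[n prime] χ(n)/√n` (coefficients of `π_{1/2}(x, χ) = Σ_{p ≤ x} χ(p)/√p`). [folklore] -/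
def primeCoeff (n : ℕ) : ℂ := if n.Prime then χ n / (Real.sqrt n : ℂ) else 0

/-- The prime-square part: `a_χ(n)/log n` on `n = p²`, else `0`. [folklore] -/
def sqCoeff (n : ℕ) : ℂ := if IsPrimePow n ∧ expo n = 2 then qCoeff χ n else 0

/-- The higher part: `a_χ(n)/log n` on `n = p^k`, `k ≥ 3`, else `0`. [folklore] -/
def highCoeff (n : ℕ) : ℂ := if IsPrimePow n ∧ 3 ≤ expo n then qCoeff χ n else 0

/-- `expo (p^k) = k` for a prime `p` and `k ≥ 1`. [folklore] -/
private theorem expo_prime_pow {p k : ℕ} (hp : p.Prime) (hk : k ≠ 0) : expo (p ^ k) = k := by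
  rw [expo, hp.pow_minFac hk, hp.factorization_pow, Finsupp.single_eq_same]

/-- `a_χ(p^k)/log(p^k) = t_χ(p, k)` for a prime `p` and `k ≥ 1`. [folklore] -/
private theorem qCoeff_prime_pow {p k : ℕ} (hp : p.Prime) (hk : k ≠ 0) : qCoeff χ (p ^ k) = primePowTerm χ p k := by
  have hp0 : (0 : ℝ) < p := by exact_mod_cast hp.pos
  have hlogp : Real.log p ≠ 0 := (Real.log_pos (by exact_mod_cast hp.one_lt)).ne'
  have hsqrt : Real.sqrt ((p : ℝ) ^ k) = Real.sqrt p ^ k := by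
    rw [show ((p : ℝ) ^ k) = (Real.sqrt p ^ k) ^ 2 by
      rw [← pow_mul, mul_comm, pow_mul, Real.sq_sqrt hp0.le], Real.sqrt_sq (pow_nonneg (Real.sqrt_nonneg _) _)]
  have hlogC : Complex.log (p : ℂ) ≠ 0 := by
    rw [← Complex.natCast_log]; exact_mod_cast hlogp
  rw [qCoeff, halfCoeff, primePowTerm, vonMangoldt_apply_pow hk, vonMangoldt_apply_prime hp, Nat.cast_pow,
    Nat.cast_pow, Real.log_pow, map_pow, hsqrt]
  push_cast
  field_simp

/-- `a_χ(n)/log n = [n prime]χ(n)/√n + (square part) + (higher part)` pointwise: the passage from `Λ(n)χ(n)n^{-1/2}`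
to `π_{1/2}(x, χ) = Σ_{p ≤ x} χ(p)/√p` (the paper's `ψ ↦ θ ↦ π`, here at the level of coefficients).
[cite: Hayani2025, Thm 1.4 (proof, §3)] -/
theorem qCoeff_eq_add (n : ℕ) : qCoeff χ n = primeCoeff χ n + sqCoeff χ n + highCoeff χ n := by
  by_cases hpp : IsPrimePow n
  · obtain ⟨p, k, hp, hk, rfl⟩ := (isPrimePow_nat_iff _).1 hpp
    have hk0 : k ≠ 0 := by omega
    have hex : expo (p ^ k) = k := expo_prime_pow hp hk0
    simp only [primeCoeff, sqCoeff, highCoeff, hpp, hex, true_and]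
    rcases Nat.lt_or_ge k 3 with h3 | h3
    · interval_cases k
      · -- `k = 1`: a prime
        rw [pow_one, if_pos hp, if_neg (by omega), if_neg (by omega), add_zero, add_zero,
          ← pow_one p, qCoeff_prime_pow χ hp one_ne_zero, primePowTerm]
        simp
      · -- `k = 2`
        rw [if_neg (Nat.Prime.not_prime_pow' ?_ |> fun h ↦ h), if_pos rfl, if_neg (by omega)]
        · ring
        · norm_num
    · have hnp : ¬ (p ^ k).Prime := Nat.Prime.not_prime_pow' (by omega)
      rw [if_neg hnp, if_neg (by omega), if_pos h3]
      ring
  · have hΛ : Λ n = 0 := vonMangoldt_eq_zero_iff.2 hpp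
    have hnp : ¬ n.Prime := fun h ↦ hpp h.isPrimePow
    simp [qCoeff, halfCoeff, primeCoeff, sqCoeff, highCoeff, hpp, hnp, hΛ]

/-! ## §3 The three parts as sums over primes -/

/-- `Σ_{n ≤ N} sqCoeff(n) = Σ_{p prime, p² ≤ N} χ(p)²/(2p)`. [folklore] -/
private theorem sum_sqCoeff (N : ℕ) :
    ∑ n ∈ Finset.Icc 1 N, sqCoeff χ n =
      ∑ p ∈ (Finset.Icc 1 (Nat.sqrt N)).filter Nat.Prime, χ p ^ 2 / (2 * (p : ℂ)) := by
  have h1 : ∑ n ∈ Finset.Icc 1 N, sqCoeff χ n = ∑ n ∈ (Finset.Icc 1 N).filter IsPrimePow, sqCoeff χ n := by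
    rw [Finset.sum_filter]
    refine Finset.sum_congr rfl fun n _ ↦ ?_
    by_cases h : IsPrimePow n
    · rw [if_pos h]
    · rw [if_neg h, sqCoeff, if_neg (fun h' ↦ h h'.1)]
  rw [h1, sum_filter_isPrimePow_eq]
  -- inner sum: only `k = 2` survives, and only when `p² ≤ N`
  have h2 : ∀ p ∈ (Finset.Icc 1 N).filter Nat.Prime,
      ∑ k ∈ Finset.Icc 1 (Nat.log p N), sqCoeff χ (p ^ k) = if p ^ 2 ≤ N then χ p ^ 2 / (2 * (p : ℂ)) else 0 := by
    intro p hp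
    have hpr : p.Prime := (Finset.mem_filter.1 hp).2
    have hterm : ∀ k ∈ Finset.Icc 1 (Nat.log p N), sqCoeff χ (p ^ k) = if k = 2 then χ p ^ 2 / (2 * (p : ℂ)) else 0 := by
      intro k hk
      rw [Finset.mem_Icc] at hk
      have hk0 : k ≠ 0 := by omega
      rw [sqCoeff, expo_prime_pow hpr hk0]
      by_cases hk2 : k = 2
      · subst hk2
        have hp0 : (0 : ℝ) ≤ p := by positivity
        rw [if_pos ⟨hpr.isPrimePow.pow two_ne_zero, rfl⟩, if_pos rfl, qCoeff_prime_pow χ hpr two_ne_zero,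
          primePowTerm, ← Complex.ofReal_pow, Real.sq_sqrt hp0]
        push_cast
        ring
      · rw [if_neg (fun h ↦ hk2 h.2), if_neg hk2]
    rw [Finset.sum_congr rfl hterm, Finset.sum_ite_eq' (Finset.Icc 1 (Nat.log p N)) 2]
    have hN : p ^ 2 ≤ N ↔ 2 ∈ Finset.Icc 1 (Nat.log p N) := by
      rw [Finset.mem_Icc]
      constructor
      · intro h; exact ⟨by norm_num, Nat.le_log_of_pow_le hpr.one_lt h⟩
      · rintro ⟨-, h⟩
        have hN0 : N ≠ 0 := by
          rintro rfl; rw [Nat.log_zero_right] at h; omega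
        exact Nat.pow_le_of_le_log hN0 h
    by_cases h : p ^ 2 ≤ N
    · rw [if_pos (hN.1 h), if_pos h]
    · rw [if_neg (fun h' ↦ h (hN.2 h')), if_neg h]
  rw [Finset.sum_congr rfl h2, ← Finset.sum_filter]
  refine Finset.sum_congr ?_ fun _ _ ↦ rfl
  ext p
  simp only [Finset.mem_filter, Finset.mem_Icc, Nat.le_sqrt']
  constructor
  · rintro ⟨⟨⟨h1, -⟩, hp⟩, h2⟩; exact ⟨⟨h1, by nlinarith [h2]⟩, hp⟩
  · rintro ⟨⟨h1, h2⟩, hp⟩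
    refine ⟨⟨⟨h1, le_trans (Nat.le_self_pow two_ne_zero p) (by nlinarith)⟩, hp⟩, by nlinarith⟩

/-- `Σ_{n ≤ N} highCoeff(n) = Σ_{p ≤ N prime} Σ_{3 ≤ k ≤ log_p N} t_χ(p, k)`. [folklore] -/
private theorem sum_highCoeff (N : ℕ) :
    ∑ n ∈ Finset.Icc 1 N, highCoeff χ n =
      ∑ p ∈ (Finset.Icc 1 N).filter Nat.Prime, ∑ k ∈ Finset.Icc 3 (Nat.log p N), primePowTerm χ p k := by
  have h1 : ∑ n ∈ Finset.Icc 1 N, highCoeff χ n = ∑ n ∈ (Finset.Icc 1 N).filter IsPrimePow, highCoeff χ n := by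
    rw [Finset.sum_filter]
    refine Finset.sum_congr rfl fun n _ ↦ ?_
    by_cases h : IsPrimePow n
    · rw [if_pos h]
    · rw [if_neg h, highCoeff, if_neg (fun h' ↦ h h'.1)]
  rw [h1, sum_filter_isPrimePow_eq]
  refine Finset.sum_congr rfl fun p hp ↦ ?_
  have hpr : p.Prime := (Finset.mem_filter.1 hp).2
  have hterm : ∀ k ∈ Finset.Icc 1 (Nat.log p N),
      highCoeff χ (p ^ k) = if 3 ≤ k then primePowTerm χ p k else 0 := by
    intro k hk
    rw [Finset.mem_Icc] at hk
    have hk0 : k ≠ 0 := by omega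
    rw [highCoeff, expo_prime_pow hpr hk0]
    by_cases hk3 : 3 ≤ k
    · rw [if_pos ⟨hpr.isPrimePow.pow hk0, hk3⟩, if_pos hk3, qCoeff_prime_pow χ hpr hk0]
    · rw [if_neg (fun h ↦ hk3 h.2), if_neg hk3]
  rw [Finset.sum_congr rfl hterm, ← Finset.sum_filter]
  refine Finset.sum_congr ?_ fun _ _ ↦ rfl
  ext k
  simp only [Finset.mem_filter, Finset.mem_Icc]
  omega

/-! ## §4 The higher prime powers: `Σ_{p^k ≤ N, k ≥ 3} t_χ(p,k) = C₃ + O(1/log N)` -/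

/-- `‖t_χ(p, k)‖ ≤ 1/(k (√p)^k) ≤ ((√p)^k)⁻¹`. [folklore] -/
private theorem norm_primePowTerm_le {p k : ℕ} (hp : p.Prime) (hk : k ≠ 0) :
    ‖primePowTerm χ p k‖ ≤ ((k : ℝ) * Real.sqrt p ^ k)⁻¹ := by
  have hsp : 0 < Real.sqrt p := Real.sqrt_pos.2 (by exact_mod_cast hp.pos)
  have hk0 : (0 : ℝ) < k := by exact_mod_cast Nat.pos_of_ne_zero hk
  rw [primePowTerm, norm_div, norm_mul, Complex.norm_natCast, norm_pow, norm_pow, Complex.norm_real,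
    Real.norm_of_nonneg hsp.le]
  refine div_le_of_le_mul₀ (by positivity) (by positivity) ?_
  rw [inv_mul_cancel₀ (by positivity)]
  exact pow_le_one₀ (norm_nonneg _) (χ.norm_le_one _)

/-- The pair function `F(p, k) = [p prime, k ≥ 3] t_χ(p, k)` on `ℕ × ℕ`. [folklore] -/
def highPair (x : ℕ × ℕ) : ℂ := if x.1.Prime ∧ 3 ≤ x.2 then primePowTerm χ x.1 x.2 else 0

/-- The majorant weight `G(p, k) = [p prime, k ≥ 3] log p · ((√p)^k)⁻¹`. [folklore] -/
def highWeight (x : ℕ × ℕ) : ℝ := if x.1.Prime ∧ 3 ≤ x.2 then Real.log x.1 * (Real.sqrt x.1 ^ x.2)⁻¹ else 0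

omit χ in
/-- `G ≥ 0`. [folklore] -/
private theorem highWeight_nonneg (x : ℕ × ℕ) : 0 ≤ highWeight x := by
  unfold highWeight
  split_ifs with h
  · exact mul_nonneg (Real.log_nonneg (by exact_mod_cast h.1.one_lt.le)) (inv_nonneg.2 (pow_nonneg (Real.sqrt_nonneg _) _))
  · exact le_rfl

omit χ in
/-- For a prime `p` and `k ≥ 3`: `log p · ((√p)^k)⁻¹ ≤ 8√2 · p^{-5/4} · ((√2)^k)⁻¹`. [folklore] -/
private theorem highWeight_le_aux {p k : ℕ} (hp : p.Prime) (hk : 3 ≤ k) :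
    Real.log p * (Real.sqrt p ^ k)⁻¹ ≤
      (8 * Real.sqrt 2 * (p : ℝ) ^ (-(5 : ℝ) / 4)) * ((Real.sqrt 2)⁻¹) ^ k := by
  have hp2 : (2 : ℝ) ≤ p := by exact_mod_cast hp.two_le
  have hp0 : (0 : ℝ) < p := by linarith
  have hs2 : 0 < Real.sqrt 2 := Real.sqrt_pos.2 (by norm_num)
  have hsp : Real.sqrt 2 ≤ Real.sqrt p := Real.sqrt_le_sqrt hp2
  have hsp0 : 0 < Real.sqrt p := lt_of_lt_of_le hs2 hsp
  -- `log p ≤ 4 p^{1/4}`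
  have hlog : Real.log p ≤ 4 * (p : ℝ) ^ ((1 : ℝ) / 4) := by
    have h := Real.log_le_rpow_div hp0.le (by norm_num : (0 : ℝ) < 1 / 4)
    linarith [h]
  -- `(√p)^k ≥ (√p)^3 (√2)^(k-3)`
  have hpow : Real.sqrt p ^ 3 * Real.sqrt 2 ^ (k - 3) ≤ Real.sqrt p ^ k := by
    calc Real.sqrt p ^ 3 * Real.sqrt 2 ^ (k - 3) ≤ Real.sqrt p ^ 3 * Real.sqrt p ^ (k - 3) := by
          gcongr
      _ = Real.sqrt p ^ k := by rw [← pow_add]; congr 1; omega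
  -- `(√p)^3 = p · √p = p^{3/2}` and `p^{1/4} / p^{3/2} = p^{-5/4}`
  have hsq3 : Real.sqrt p ^ 3 = (p : ℝ) ^ ((3 : ℝ) / 2) := by
    rw [Real.sqrt_eq_rpow, ← Real.rpow_natCast, ← Real.rpow_mul hp0.le]; norm_num
  have hcomb : (p : ℝ) ^ ((1 : ℝ) / 4) * ((p : ℝ) ^ ((3 : ℝ) / 2))⁻¹ = (p : ℝ) ^ (-(5 : ℝ) / 4) := by
    rw [← Real.rpow_neg hp0.le, ← Real.rpow_add hp0]; norm_num
  have h2k : Real.sqrt 2 ^ (k - 3) = Real.sqrt 2 ^ k * ((Real.sqrt 2)⁻¹) ^ 3 := by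
    rw [inv_pow, ← div_eq_mul_inv, eq_div_iff (by positivity), ← pow_add]; congr 1; omega
  have hs23 : ((Real.sqrt 2)⁻¹) ^ 3 = (2 * Real.sqrt 2)⁻¹ := by
    rw [inv_pow]
    congr 1
    rw [pow_succ, Real.sq_sqrt (by norm_num : (0:ℝ) ≤ 2)]
  calc Real.log p * (Real.sqrt p ^ k)⁻¹
      ≤ (4 * (p : ℝ) ^ ((1 : ℝ) / 4)) * (Real.sqrt p ^ 3 * Real.sqrt 2 ^ (k - 3))⁻¹ := by
        gcongr
    _ = (8 * Real.sqrt 2 * (p : ℝ) ^ (-(5 : ℝ) / 4)) * ((Real.sqrt 2)⁻¹) ^ k := by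
        rw [hsq3, h2k, hs23, mul_inv, mul_inv, inv_inv, ← hcomb, inv_pow]
        ring

omit χ in
/-- The weight `G` is summable over `ℕ × ℕ`. [folklore] -/
private theorem summable_highWeight : Summable highWeight := by
  have hs2 : 0 < Real.sqrt 2 := Real.sqrt_pos.2 (by norm_num)
  have hs21 : (Real.sqrt 2)⁻¹ < 1 := by
    rw [inv_lt_one_iff₀]; right
    rw [show (1 : ℝ) = Real.sqrt 1 by simp]
    exact Real.sqrt_lt_sqrt (by norm_num) (by norm_num)
  have hH : Summable fun p : ℕ ↦ 8 * Real.sqrt 2 * (p : ℝ) ^ (-(5 : ℝ) / 4) :=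
    (Real.summable_nat_rpow.2 (by norm_num)).mul_left _
  have hK : Summable fun k : ℕ ↦ ((Real.sqrt 2)⁻¹) ^ k := summable_geometric_of_lt_one (by positivity) hs21
  have hprod := hH.mul_of_nonneg hK (fun p ↦ by positivity) (fun k ↦ by positivity)
  refine Summable.of_nonneg_of_le highWeight_nonneg (fun x ↦ ?_) hprod
  unfold highWeight
  split_ifs with h
  · exact highWeight_le_aux h.1 h.2
  · positivity

/-- `‖F(x)‖ ≤ G(x)/log 2` everywhere, hence `F` is summable. [folklore] -/
private theorem norm_highPair_le (x : ℕ × ℕ) : ‖highPair χ x‖ ≤ highWeight x / Real.log 2 := by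
  have hl2 : 0 < Real.log 2 := Real.log_pos (by norm_num)
  unfold highPair highWeight
  split_ifs with h
  · obtain ⟨hp, hk⟩ := h
    have hk0 : x.2 ≠ 0 := by omega
    have hsp : 0 < Real.sqrt x.1 := Real.sqrt_pos.2 (by exact_mod_cast hp.pos)
    have hlogp : Real.log 2 ≤ Real.log x.1 := Real.log_le_log (by norm_num) (by exact_mod_cast hp.two_le)
    have hk1 : (1 : ℝ) ≤ x.2 := by exact_mod_cast Nat.one_le_iff_ne_zero.2 hk0
    refine (norm_primePowTerm_le χ hp hk0).trans ?_
    rw [le_div_iff₀ hl2, mul_inv, mul_comm, ← mul_assoc]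
    refine mul_le_mul ?_ le_rfl (by positivity) (Real.log_nonneg (by exact_mod_cast hp.one_lt.le))
    calc Real.log 2 * ((x.2 : ℝ))⁻¹ ≤ Real.log 2 * 1 := by
          gcongr; exact inv_le_one_of_one_le₀ hk1
      _ ≤ Real.log x.1 := by rw [mul_one]; exact hlogp
  · simp

/-- `F` is summable. [folklore] -/
private theorem summable_highPair : Summable (highPair χ) :=
  Summable.of_norm_bounded (summable_highWeight.div_const _) (norm_highPair_le χ)

/-- The constant `C₃(χ) = Σ_{p, k ≥ 3} χ(p)^k/(k p^{k/2})`. [folklore] -/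
def highConst : ℂ := ∑' x : ℕ × ℕ, highPair χ x

/-- The finite set of pairs `(p, k)`, `p ≤ N` prime, `3 ≤ k`, `p^k ≤ N`. [folklore] -/
def highPairs (N : ℕ) : Finset (ℕ × ℕ) :=
  (((Finset.Icc 1 N).filter Nat.Prime) ×ˢ Finset.Icc 3 (Nat.log 2 N)).filter fun x ↦ x.1 ^ x.2 ≤ N

/-- `Σ_{(p,k) ∈ highPairs N} F(p,k) = Σ_{n ≤ N} highCoeff(n)`. [folklore] -/
private theorem sum_highPairs (N : ℕ) :
    ∑ x ∈ highPairs N, highPair χ x = ∑ n ∈ Finset.Icc 1 N, highCoeff χ n := by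
  rw [sum_highCoeff, highPairs, Finset.sum_filter, Finset.sum_product]
  refine Finset.sum_congr rfl fun p hp ↦ ?_
  have hpr : p.Prime := (Finset.mem_filter.1 hp).2
  have hpN : p ≤ N := (Finset.mem_Icc.1 (Finset.mem_filter.1 hp).1).2
  have hN0 : N ≠ 0 := by have := hpr.pos; omega
  rw [← Finset.sum_filter]
  have hset : (Finset.Icc 3 (Nat.log 2 N)).filter (fun k ↦ p ^ k ≤ N) = Finset.Icc 3 (Nat.log p N) := by
    ext k
    simp only [Finset.mem_filter, Finset.mem_Icc]
    constructor
    · rintro ⟨⟨h3, -⟩, hk⟩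
      exact ⟨h3, Nat.le_log_of_pow_le hpr.one_lt hk⟩
    · rintro ⟨h3, hk⟩
      exact ⟨⟨h3, hk.trans (Nat.log_anti_left (by norm_num) hpr.two_le)⟩, Nat.pow_le_of_le_log hN0 hk⟩
  rw [hset]
  refine Finset.sum_congr rfl fun k hk ↦ ?_
  rw [Finset.mem_Icc] at hk
  simp only [highPair, hpr, hk.1, and_self, if_true]

/-- Outside `highPairs N` a pair `(p, k)` with `p` prime and `k ≥ 3` has `p^k > N`. [folklore] -/
private theorem lt_pow_of_not_mem {N : ℕ} {x : ℕ × ℕ} (hx : x ∉ highPairs N) (hp : x.1.Prime) (hk : 3 ≤ x.2) :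
    N < x.1 ^ x.2 := by
  by_contra h
  push Not at h
  apply hx
  simp only [highPairs, Finset.mem_filter, Finset.mem_product, Finset.mem_Icc]
  have hk0 : x.2 ≠ 0 := by omega
  refine ⟨⟨⟨⟨hp.one_lt.le, le_trans (Nat.le_self_pow hk0 _) h⟩, hp⟩, hk, ?_⟩, h⟩
  exact (Nat.le_log_of_pow_le hp.one_lt h).trans (Nat.log_anti_left (by norm_num) hp.two_le)

/-- **`Σ_{n ≤ N} highCoeff(n) = C₃ + O(1/log N)`**: for `N ≥ 2`,
`‖Σ_{n ≤ N} highCoeff χ n − C₃‖ ≤ (Σ G)/log N`. [folklore] -/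
private theorem norm_sum_highCoeff_sub_le {N : ℕ} (hN : 2 ≤ N) :
    ‖∑ n ∈ Finset.Icc 1 N, highCoeff χ n - highConst χ‖ ≤ (∑' x, highWeight x) / Real.log N := by
  have hlogN : 0 < Real.log N := Real.log_pos (by exact_mod_cast hN)
  have hF := summable_highPair χ
  rw [← sum_highPairs, highConst, ← hF.sum_add_tsum_subtype_compl (highPairs N), sub_add_cancel_left, norm_neg]
  have hFs : Summable fun x : {x // x ∉ highPairs N} ↦ ‖highPair χ x‖ := (hF.norm).subtype _
  have hGs : Summable fun x : {x // x ∉ highPairs N} ↦ highWeight x / Real.log N :=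
    (summable_highWeight.subtype _).div_const _
  refine (norm_tsum_le_tsum_norm hFs).trans ?_
  have hle : ∀ x : {x // x ∉ highPairs N}, ‖highPair χ x‖ ≤ highWeight x / Real.log N := by
    rintro ⟨x, hx⟩
    simp only
    unfold highPair highWeight
    split_ifs with h
    · obtain ⟨hp, hk⟩ := h
      have hk0 : x.2 ≠ 0 := by omega
      have hsp : 0 < Real.sqrt x.1 := Real.sqrt_pos.2 (by exact_mod_cast hp.pos)
      have hp0 : (0 : ℝ) < x.1 := by exact_mod_cast hp.pos
      have hlt := lt_pow_of_not_mem hx hp hk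
      -- `log N < k log p`
      have hlogs : Real.log N ≤ x.2 * Real.log x.1 := by
        rw [← Real.log_pow]
        exact Real.log_le_log (by positivity) (by exact_mod_cast hlt.le)
      refine (norm_primePowTerm_le χ hp hk0).trans ?_
      rw [le_div_iff₀ hlogN, mul_inv]
      have hk0' : (0 : ℝ) < x.2 := by exact_mod_cast Nat.pos_of_ne_zero hk0
      calc ((x.2 : ℝ))⁻¹ * (Real.sqrt x.1 ^ x.2)⁻¹ * Real.log N
          ≤ ((x.2 : ℝ))⁻¹ * (Real.sqrt x.1 ^ x.2)⁻¹ * (x.2 * Real.log x.1) := by gcongr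
        _ = Real.log x.1 * (Real.sqrt x.1 ^ x.2)⁻¹ := by field_simp
    · simp
  refine (Summable.tsum_le_tsum hle hFs hGs).trans ?_
  rw [tsum_div_const]
  exact div_le_div_of_nonneg_right
    (Summable.tsum_subtype_le highWeight _ highWeight_nonneg summable_highWeight) hlogN.le

omit χ in
/-- `log u ≤ 2 log ⌊u⌋` for `u ≥ 3` (`⌊u⌋ ≥ u − 1 ≥ √u`). [folklore] -/
private theorem log_le_two_log_floor {u : ℝ} (hu : 3 ≤ u) : Real.log u ≤ 2 * Real.log (⌊u⌋₊ : ℝ) := by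
  have hN : u - 1 ≤ (⌊u⌋₊ : ℝ) := by
    have := Nat.lt_floor_add_one u; linarith
  have hN0 : (0 : ℝ) < ⌊u⌋₊ := by linarith
  have hsq : u ≤ ((⌊u⌋₊ : ℝ)) ^ 2 := by nlinarith
  calc Real.log u ≤ Real.log (((⌊u⌋₊ : ℝ)) ^ 2) := Real.log_le_log (by linarith) hsq
    _ = 2 * Real.log (⌊u⌋₊ : ℝ) := by rw [Real.log_pow]; push_cast; ring

/-- **The higher prime powers, pointwise in `u`**: `‖Σ_{n ≤ u} highCoeff χ n − C₃‖ ≤ K/log u` for `u ≥ 3`.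
[cite: Hayani2025, Thm 1.4 (proof, §3)] -/
theorem highPart_pointwise :
    ∃ K : ℝ, ∀ u : ℝ, 3 ≤ u → ‖∑ n ∈ Finset.Icc 1 ⌊u⌋₊, highCoeff χ n - highConst χ‖ ≤ K / Real.log u := by
  refine ⟨2 * ∑' x, highWeight x, fun u hu ↦ ?_⟩
  have hW : 0 ≤ ∑' x, highWeight x := tsum_nonneg highWeight_nonneg
  have hN2 : 2 ≤ ⌊u⌋₊ := Nat.le_floor (by push_cast; linarith)
  have hlogu : 0 < Real.log u := Real.log_pos (by linarith)
  have hlogN : Real.log u / 2 ≤ Real.log (⌊u⌋₊ : ℝ) := by linarith [log_le_two_log_floor hu]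
  refine (norm_sum_highCoeff_sub_le χ hN2).trans ?_
  calc (∑' x, highWeight x) / Real.log (⌊u⌋₊ : ℝ) ≤ (∑' x, highWeight x) / (Real.log u / 2) :=
        div_le_div_of_nonneg_left hW (by positivity) hlogN
    _ = 2 * (∑' x, highWeight x) / Real.log u := by field_simp

/-! ## §5 Mertens' second theorem for `χ²`: principal case (tree) and non-principal case under GRH -/

section Mertens

variable [NeZero q]

omit χ in
/-- `Nat.primesLE n` is `{p ∈ [1, n] : p prime}`. [folklore] -/
private theorem sum_primesLE_eq (f : ℕ → ℝ) (n : ℕ) :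
    ∑ p ∈ Nat.primesLE n, f p = ∑ p ∈ (Finset.Icc 1 n).filter Nat.Prime, f p := by
  refine Finset.sum_congr ?_ fun _ _ ↦ rfl
  ext p
  simp only [Nat.mem_primesLE, Finset.mem_filter, Finset.mem_Icc]
  constructor
  · rintro ⟨h1, h2⟩; exact ⟨⟨h2.one_lt.le, h1⟩, h2⟩
  · rintro ⟨⟨-, h1⟩, h2⟩; exact ⟨h1, h2⟩

omit [NeZero q] χ in
/-- The principal character on primes: `χ₀(p) = 1` if `p ∤ q`, `0` if `p ∣ q`. [folklore] -/
private theorem one_apply_prime {p : ℕ} (hp : p.Prime) :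
    (1 : DirichletCharacter ℂ q) (p : ZMod q) = if p ∣ q then 0 else 1 := by
  by_cases h : p ∣ q
  · rw [if_pos h]
    exact MulChar.map_nonunit _ (fun hu ↦ (ZMod.isUnit_prime_iff_not_dvd hp).1 hu h)
  · rw [if_neg h]
    exact MulChar.one_apply ((ZMod.isUnit_prime_iff_not_dvd hp).2 h)

omit χ in
/-- **Mertens II for the principal character**: for `y ≥ max(2, q)`,
`‖Σ_{p ≤ y} χ₀(p)/p − log log y − (B − Σ_{p ∣ q} 1/p)‖ ≤ 8/log y` (`B` = Meissel–Mertens).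
[cite: HardyWright2008, Thm 427 (§22.7)] -/
theorem norm_sum_principal_div_prime_sub_le {y : ℝ} (hy : 2 ≤ y) (hqy : (q : ℝ) ≤ y) :
    ‖∑ p ∈ (Finset.Icc 1 ⌊y⌋₊).filter Nat.Prime, (1 : DirichletCharacter ℂ q) (p : ZMod q) / (p : ℂ) -
        (Real.log (Real.log y) : ℂ) -
        ((Mertens.meisselMertens - ∑ p ∈ q.primeFactors, (p : ℝ)⁻¹ : ℝ) : ℂ)‖ ≤ 8 / Real.log y := by
  have hq0 : q ≠ 0 := NeZero.ne q
  -- the sum is `primeRecipSum y − Σ_{p ∣ q} 1/p`, as a real number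
  have hsum : ∑ p ∈ (Finset.Icc 1 ⌊y⌋₊).filter Nat.Prime, (1 : DirichletCharacter ℂ q) (p : ZMod q) / (p : ℂ) =
      ((Mertens.primeRecipSum y - ∑ p ∈ q.primeFactors, (p : ℝ)⁻¹ : ℝ) : ℂ) := by
    rw [Mertens.primeRecipSum, sum_primesLE_eq]
    -- split the primes `≤ ⌊y⌋` into `p ∤ q` and `p ∣ q`; the latter are exactly `q.primeFactors`
    have hsub : q.primeFactors ⊆ (Finset.Icc 1 ⌊y⌋₊).filter Nat.Prime := by
      intro p hp
      have hpr := Nat.prime_of_mem_primeFactors hp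
      have hple : p ≤ q := Nat.le_of_mem_primeFactors hp
      refine Finset.mem_filter.2 ⟨Finset.mem_Icc.2 ⟨hpr.one_lt.le, Nat.le_floor ?_⟩, hpr⟩
      exact le_trans (by exact_mod_cast hple) hqy
    rw [← Finset.sum_sdiff hsub, ← Finset.sum_sdiff hsub]
    have h1 : ∑ p ∈ q.primeFactors, (1 : DirichletCharacter ℂ q) (p : ZMod q) / (p : ℂ) = 0 := by
      refine Finset.sum_eq_zero fun p hp ↦ ?_
      rw [one_apply_prime (Nat.prime_of_mem_primeFactors hp), if_pos (Nat.dvd_of_mem_primeFactors hp), zero_div]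
    have h2 : ∑ p ∈ (Finset.Icc 1 ⌊y⌋₊).filter Nat.Prime \ q.primeFactors,
        (1 : DirichletCharacter ℂ q) (p : ZMod q) / (p : ℂ) =
        ∑ p ∈ (Finset.Icc 1 ⌊y⌋₊).filter Nat.Prime \ q.primeFactors, ((p : ℝ)⁻¹ : ℂ) := by
      refine Finset.sum_congr rfl fun p hp ↦ ?_
      rw [Finset.mem_sdiff, Finset.mem_filter] at hp
      have hpr := hp.1.2
      have hnd : ¬ p ∣ q := fun h ↦ hp.2 (Nat.mem_primeFactors.2 ⟨hpr, h, hq0⟩)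
      rw [one_apply_prime hpr, if_neg hnd]
      push_cast
      ring
    rw [h1, h2, add_zero]
    push_cast
    ring
  rw [hsum]
  have h := Mertens.abs_primeRecipSum_sub_le hy
  rw [← Complex.ofReal_sub, ← Complex.ofReal_sub, Complex.norm_real, Real.norm_eq_abs]
  have : Mertens.primeRecipSum y - ∑ p ∈ q.primeFactors, (p : ℝ)⁻¹ - Real.log (Real.log y) -
      (Mertens.meisselMertens - ∑ p ∈ q.primeFactors, (p : ℝ)⁻¹) =
      Mertens.primeRecipSum y - Real.log (Real.log y) - Mertens.meisselMertens := by ring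
  rw [this]
  exact h

/-- `π(n, ψ) = Σ_{p ≤ n} ψ(p)` over `Finset.Icc 1 n` (the tree's prime sums use `Finset.Icc 0 n`; `0` is not prime).
[folklore] -/
def primeSum (ψ : DirichletCharacter ℂ q) (n : ℕ) : ℂ := ∑ p ∈ (Finset.Icc 1 n).filter Nat.Prime, ψ p

omit [NeZero q] χ in
/-- `π(n, ψ)` over `Icc 1 n` equals the tree's sum over `Icc 0 n`. [folklore] -/
private theorem primeSum_eq_Icc_zero (ψ : DirichletCharacter ℂ q) (n : ℕ) :
    primeSum ψ n = ∑ p ∈ (Finset.Icc 0 n).filter Nat.Prime, ψ p := by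
  rw [primeSum]
  refine Finset.sum_congr ?_ fun _ _ ↦ rfl
  ext p
  simp only [Finset.mem_filter, Finset.mem_Icc]
  constructor
  · rintro ⟨⟨-, h⟩, hp⟩; exact ⟨⟨Nat.zero_le _, h⟩, hp⟩
  · rintro ⟨⟨-, h⟩, hp⟩; exact ⟨⟨hp.one_lt.le, h⟩, hp⟩

omit [NeZero q] χ in
/-- `π(n, ψ)` as a sum of `if`s. [folklore] -/
private theorem primeSum_eq_sum_ite (ψ : DirichletCharacter ℂ q) (n : ℕ) :
    primeSum ψ n = ∑ p ∈ Finset.Icc 1 n, if p.Prime then ψ p else 0 := by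
  rw [primeSum, Finset.sum_filter]

omit [NeZero q] χ in
/-- `π(n+1, ψ) = π(n, ψ) + [n+1 prime] ψ(n+1)`. [folklore] -/
private theorem primeSum_succ (ψ : DirichletCharacter ℂ q) (n : ℕ) :
    primeSum ψ (n + 1) = primeSum ψ n + if (n + 1).Prime then ψ (n + 1 : ℕ) else 0 := by
  rw [primeSum_eq_sum_ite, primeSum_eq_sum_ite, Finset.sum_Icc_succ_top (by omega)]

omit [NeZero q] χ in
/-- `π(n, ψ) = 0` for `n ≤ 1`. [folklore] -/
private theorem primeSum_of_lt_two (ψ : DirichletCharacter ℂ q) {n : ℕ} (hn : n < 2) : primeSum ψ n = 0 := by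
  rw [primeSum]
  refine Finset.sum_eq_zero fun p hp ↦ ?_
  rw [Finset.mem_filter, Finset.mem_Icc] at hp
  exfalso; have := hp.2.two_le; omega

omit χ in
/-- **`|π(n, ψ)| ≤ A n^{5/8}` under GRH** for a non-principal `ψ` (from MV Thm 13.7 (13.21) in the tree,
`GRHPrimeCharSum.exists_norm_primeSum_le_of_isPrimitive`, with `log(dN) ≤ 8(dN)^{1/8}`).
[cite: MontgomeryVaughan2007, §13.1 Thm 13.7 (13.21)] -/
private theorem exists_norm_primeSum_le_rpow (ψ : DirichletCharacter ℂ q) (hψ : ψ ≠ 1) (hGRH : ψ.RiemannHypothesis) :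
    ∃ A : ℝ, 0 ≤ A ∧ ∀ n : ℕ, ‖primeSum ψ n‖ ≤ A * (n : ℝ) ^ ((5 : ℝ) / 8) := by
  classical
  obtain ⟨B, hB0, hB⟩ := GRHPrimeCharSum.exists_norm_primeSum_le_of_isPrimitive
  set d := ψ.conductor with hd
  haveI : NeZero d := ⟨ψ.conductor_ne_zero⟩
  have hd1 : d ≠ 1 := fun h ↦ hψ ((DirichletCharacter.eq_one_iff_conductor_eq_one (χ := ψ)).2 h)
  have hdgt : 1 < d := by have := NeZero.ne d; omega
  have hprim : ψ.primitiveCharacter.IsPrimitive := DirichletCharacter.primitiveCharacter_isPrimitive ψ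
  have hRH : ψ.primitiveCharacter.RiemannHypothesis :=
    (DirichletCharacter.riemannHypothesis_iff_primitiveCharacter_holds ψ).1 hGRH
  set A : ℝ := 8 * B * (d : ℝ) ^ ((1 : ℝ) / 8) + q.primeFactors.card with hA
  refine ⟨A, by positivity, fun n ↦ ?_⟩
  rcases Nat.lt_or_ge n 2 with hn | hn
  · -- `n ≤ 1`: no primes
    rw [primeSum_of_lt_two ψ hn, norm_zero]; positivity
  · have hn0 : (0 : ℝ) < n := by exact_mod_cast (by omega : 0 < n)
    have hn1 : (1 : ℝ) ≤ n := by exact_mod_cast (by omega : 1 ≤ n)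
    have hd0 : (0 : ℝ) < d := by exact_mod_cast (by omega : 0 < d)
    have h1 := hB d ψ.primitiveCharacter hprim hdgt hRH n hn
    have h2 := GRHPrimeCharSum.norm_primeSum_sub_primitive_le ψ n
    -- `log(dn) ≤ 8 (dn)^{1/8} = 8 d^{1/8} n^{1/8}` and `√n · n^{1/8} = n^{5/8}`
    have hlog : Real.log (d * n) ≤ 8 * ((d : ℝ) ^ ((1 : ℝ) / 8) * (n : ℝ) ^ ((1 : ℝ) / 8)) := by
      have h := Real.log_le_rpow_div (by positivity : (0 : ℝ) ≤ d * n) (by norm_num : (0 : ℝ) < 1 / 8)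
      rw [Real.mul_rpow hd0.le hn0.le] at h
      linarith
    have hsqrt : Real.sqrt n * (n : ℝ) ^ ((1 : ℝ) / 8) = (n : ℝ) ^ ((5 : ℝ) / 8) := by
      rw [Real.sqrt_eq_rpow, ← Real.rpow_add hn0]; norm_num
    have h58 : (1 : ℝ) ≤ (n : ℝ) ^ ((5 : ℝ) / 8) := Real.one_le_rpow hn1 (by norm_num)
    rw [primeSum_eq_Icc_zero]
    calc ‖∑ p ∈ (Finset.Icc 0 n).filter Nat.Prime, ψ p‖
        ≤ ‖∑ p ∈ (Finset.Icc 0 n).filter Nat.Prime, ψ.primitiveCharacter p‖ +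
            ‖∑ p ∈ (Finset.Icc 0 n).filter Nat.Prime, ψ p -
              ∑ p ∈ (Finset.Icc 0 n).filter Nat.Prime, ψ.primitiveCharacter p‖ := by
          have := norm_add_le (∑ p ∈ (Finset.Icc 0 n).filter Nat.Prime, ψ.primitiveCharacter p)
            (∑ p ∈ (Finset.Icc 0 n).filter Nat.Prime, ψ p -
              ∑ p ∈ (Finset.Icc 0 n).filter Nat.Prime, ψ.primitiveCharacter p)
          rwa [add_sub_cancel] at this
      _ ≤ B * Real.sqrt n * Real.log (d * n) + q.primeFactors.card := add_le_add h1 h2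
      _ ≤ B * Real.sqrt n * (8 * ((d : ℝ) ^ ((1 : ℝ) / 8) * (n : ℝ) ^ ((1 : ℝ) / 8))) +
            q.primeFactors.card * (n : ℝ) ^ ((5 : ℝ) / 8) := by
          gcongr
          exact le_mul_of_one_le_right (by positivity) h58
      _ = A * (n : ℝ) ^ ((5 : ℝ) / 8) := by
          rw [hA, ← hsqrt]; ring

omit [NeZero q] χ in
/-- Abel summation: `Σ_{p ≤ N} ψ(p)/p = Σ_{n=1}^{N} π(n)/(n(n+1)) + π(N)/(N+1)`. [folklore] -/
private theorem sum_div_prime_eq_abel (ψ : DirichletCharacter ℂ q) (N : ℕ) :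
    ∑ p ∈ (Finset.Icc 1 N).filter Nat.Prime, ψ p / (p : ℂ) =
      ∑ n ∈ Finset.Icc 1 N, primeSum ψ n / ((n : ℂ) * (n + 1)) + primeSum ψ N / ((N : ℂ) + 1) := by
  rw [Finset.sum_filter]
  induction N with
  | zero => simp [primeSum]
  | succ N ih =>
    rw [Finset.sum_Icc_succ_top (by omega), Finset.sum_Icc_succ_top (by omega), ih, primeSum_succ]
    have hN1 : ((N : ℂ) + 1) ≠ 0 := by exact_mod_cast Nat.succ_ne_zero N
    have hN2 : ((N : ℂ) + 1 + 1) ≠ 0 := by exact_mod_cast Nat.succ_ne_zero (N + 1)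
    split_ifs with h
    · push_cast
      field_simp
      ring
    · push_cast
      field_simp
      ring

omit χ in
/-- **Mertens II for a non-principal character under GRH**: if `ψ ≠ χ₀` satisfies GRH then
`Σ_{p ≤ N} ψ(p)/p = B_ψ + O(1/log N)`: `‖Σ_{p ≤ N} ψ(p)/p − B_ψ‖ ≤ K/log N` for `N ≥ 2` (some `B_ψ`, `K ≥ 0`), by Abel
summation from `π(n, ψ) ≪ n^{5/8}` (MV Thm 13.7 (13.21) in the tree) — «the following form of Mertens' theorem
`Σ_{p ≤ x} χ(p²)/p = ⟨χ,r⟩ log log x + c + O(1/log x)`», non-principal part.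
[cite: Hayani2025, Thm 1.3 (proof, §3: Mertens' theorem for `χ(p²)/p`)] -/
theorem exists_norm_sum_char_div_prime_sub_le (ψ : DirichletCharacter ℂ q) (hψ : ψ ≠ 1)
    (hGRH : ψ.RiemannHypothesis) :
    ∃ Bψ : ℂ, ∃ K : ℝ, 0 ≤ K ∧ ∀ N : ℕ, 2 ≤ N →
      ‖∑ p ∈ (Finset.Icc 1 N).filter Nat.Prime, ψ p / (p : ℂ) - Bψ‖ ≤ K / Real.log N := by
  obtain ⟨A, hA0, hA⟩ := exists_norm_primeSum_le_rpow ψ hψ hGRH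
  -- the series `Σ π(n)/(n(n+1))` and its `log`-weighted majorant
  set g : ℕ → ℂ := fun n ↦ primeSum ψ n / ((n : ℂ) * (n + 1)) with hg
  set h : ℕ → ℝ := fun n ↦ 8 * A * (n : ℝ) ^ (-(5 : ℝ) / 4) with hh
  have hh_sum : Summable h := (Real.summable_nat_rpow.2 (by norm_num)).mul_left _
  have hh0 : ∀ n, 0 ≤ h n := fun n ↦ by positivity
  -- `‖g n‖ log n ≤ h n` and `‖g n‖ ≤ h n`
  have hg_log : ∀ n : ℕ, ‖g n‖ * Real.log n ≤ h n := by
    intro n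
    rcases Nat.eq_zero_or_pos n with rfl | hn
    · simp [hg, hh]
    have hn0 : (0 : ℝ) < n := by exact_mod_cast hn
    have hlog : Real.log n ≤ 8 * (n : ℝ) ^ ((1 : ℝ) / 8) := by
      have h := Real.log_le_rpow_div hn0.le (by norm_num : (0 : ℝ) < 1 / 8)
      linarith
    have hnorm : ‖g n‖ ≤ A * (n : ℝ) ^ ((5 : ℝ) / 8) / ((n : ℝ) * (n + 1)) := by
      rw [hg, norm_div, norm_mul, Complex.norm_natCast]
      have : ‖(n : ℂ) + 1‖ = (n : ℝ) + 1 := by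
        rw [show (n : ℂ) + 1 = ((n + 1 : ℕ) : ℂ) by push_cast; ring, Complex.norm_natCast]; push_cast; ring
      rw [this]
      exact div_le_div_of_nonneg_right (hA n) (by positivity)
    calc ‖g n‖ * Real.log n ≤ (A * (n : ℝ) ^ ((5 : ℝ) / 8) / ((n : ℝ) * (n + 1))) * (8 * (n : ℝ) ^ ((1 : ℝ) / 8)) :=
          mul_le_mul hnorm hlog (Real.log_nonneg (by exact_mod_cast hn)) (by positivity)
      _ ≤ (A * (n : ℝ) ^ ((5 : ℝ) / 8) / ((n : ℝ) * n)) * (8 * (n : ℝ) ^ ((1 : ℝ) / 8)) := by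
          gcongr
          linarith
      _ = h n := by
          rw [hh]
          have e1 : (n : ℝ) * n = (n : ℝ) ^ (2 : ℝ) := by rw [Real.rpow_two]; ring
          rw [e1]
          have e2 : (n : ℝ) ^ ((5 : ℝ) / 8) / (n : ℝ) ^ (2 : ℝ) * (n : ℝ) ^ ((1 : ℝ) / 8) =
              (n : ℝ) ^ (-(5 : ℝ) / 4) := by
            rw [div_eq_mul_inv, ← Real.rpow_neg hn0.le, ← Real.rpow_add hn0, ← Real.rpow_add hn0]; norm_num
          calc A * (n : ℝ) ^ ((5 : ℝ) / 8) / (n : ℝ) ^ (2 : ℝ) * (8 * (n : ℝ) ^ ((1 : ℝ) / 8))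
              = 8 * A * ((n : ℝ) ^ ((5 : ℝ) / 8) / (n : ℝ) ^ (2 : ℝ) * (n : ℝ) ^ ((1 : ℝ) / 8)) := by ring
            _ = 8 * A * (n : ℝ) ^ (-(5 : ℝ) / 4) := by rw [e2]
  have hg_le : ∀ n : ℕ, ‖g n‖ ≤ h n / Real.log 2 := by
    intro n
    have hl2 : 0 < Real.log 2 := Real.log_pos (by norm_num)
    rcases Nat.lt_or_ge n 2 with hn | hn
    · have : g n = 0 := by simp only [hg, primeSum_of_lt_two ψ hn, zero_div]
      rw [this, norm_zero]; exact div_nonneg (hh0 n) hl2.le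
    · rw [le_div_iff₀ hl2]
      refine le_trans ?_ (hg_log n)
      exact mul_le_mul_of_nonneg_left (Real.log_le_log (by norm_num) (by exact_mod_cast hn)) (norm_nonneg _)
  have hg_sum : Summable g := Summable.of_norm_bounded (hh_sum.div_const _) hg_le
  have hsumh0 : 0 ≤ ∑' n, h n := tsum_nonneg hh0
  refine ⟨∑' n, g n, 8 / 3 * A + ∑' n, h n, by positivity, fun N hN ↦ ?_⟩
  have hN0 : (0 : ℝ) < N := by exact_mod_cast (by omega : 0 < N)
  have hlogN : 0 < Real.log N := Real.log_pos (by exact_mod_cast hN)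
  -- `Σ' g = Σ_{n ≤ N} g(n) + Σ_{n > N} g(n)`
  have hsplit : ∑' n, g n = ∑ n ∈ Finset.Icc 1 N, g n + ∑' n, g (n + (N + 1)) := by
    rw [← hg_sum.sum_add_tsum_nat_add (N + 1), Nat.range_succ_eq_Icc_zero]
    congr 1
    symm
    refine Finset.sum_subset (Finset.Icc_subset_Icc_left (Nat.zero_le 1)) fun n hn hn' ↦ ?_
    have h0 : n = 0 := by
      rw [Finset.mem_Icc] at hn hn'; omega
    subst h0
    simp [hg, primeSum_of_lt_two ψ (by norm_num : 0 < 2)]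
  -- hence the difference is `π(N)/(N+1) − Σ_{n > N} g(n)`
  have hdiff : ∑ p ∈ (Finset.Icc 1 N).filter Nat.Prime, ψ p / (p : ℂ) - ∑' n, g n =
      primeSum ψ N / ((N : ℂ) + 1) - ∑' n, g (n + (N + 1)) := by
    rw [sum_div_prime_eq_abel, hsplit]
    simp only [hg]
    ring
  rw [hdiff]
  -- the boundary term
  have h1 : ‖primeSum ψ N / ((N : ℂ) + 1)‖ ≤ 8 / 3 * A / Real.log N := by
    have hnormN : ‖(N : ℂ) + 1‖ = (N : ℝ) + 1 := by
      rw [show (N : ℂ) + 1 = ((N + 1 : ℕ) : ℂ) by push_cast; ring, Complex.norm_natCast]; push_cast; ring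
    rw [norm_div, hnormN]
    have hlog : Real.log N * (N : ℝ) ^ (-(3 : ℝ) / 8) ≤ 8 / 3 := by
      have h := Real.log_le_rpow_div hN0.le (by norm_num : (0 : ℝ) < 3 / 8)
      rw [le_div_iff₀ (by norm_num : (0:ℝ) < 3 / 8)] at h
      have e : (N : ℝ) ^ ((3 : ℝ) / 8) * (N : ℝ) ^ (-(3 : ℝ) / 8) = 1 := by
        rw [← Real.rpow_add hN0]; norm_num
      nlinarith [Real.rpow_nonneg hN0.le (-(3 : ℝ) / 8)]
    calc ‖primeSum ψ N‖ / ((N : ℝ) + 1) ≤ A * (N : ℝ) ^ ((5 : ℝ) / 8) / N := by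
          gcongr
          · exact hA N
          · linarith
      _ = A * (N : ℝ) ^ (-(3 : ℝ) / 8) := by
          rw [div_eq_mul_inv, mul_assoc, ← Real.rpow_neg_one, ← Real.rpow_add hN0]; norm_num
      _ ≤ 8 / 3 * A / Real.log N := by
          rw [le_div_iff₀ hlogN]
          nlinarith [Real.rpow_nonneg hN0.le (-(3 : ℝ) / 8)]
  -- the tail
  have h2 : ‖∑' n, g (n + (N + 1))‖ ≤ (∑' n, h n) / Real.log N := by
    have hgs : Summable fun n ↦ g (n + (N + 1)) := (summable_nat_add_iff (N + 1)).2 hg_sum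
    have hhs : Summable fun n ↦ h (n + (N + 1)) := (summable_nat_add_iff (N + 1)).2 hh_sum
    have hle : ∀ n, ‖g (n + (N + 1))‖ ≤ h (n + (N + 1)) / Real.log N := by
      intro n
      have hm : (N : ℝ) ≤ (n + (N + 1) : ℕ) := by exact_mod_cast (by omega : N ≤ n + (N + 1))
      have hlogm : Real.log N ≤ Real.log (n + (N + 1) : ℕ) := Real.log_le_log hN0 hm
      rw [le_div_iff₀ hlogN]
      exact le_trans (mul_le_mul_of_nonneg_left hlogm (norm_nonneg _)) (hg_log _)
    calc ‖∑' n, g (n + (N + 1))‖ ≤ ∑' n, ‖g (n + (N + 1))‖ := norm_tsum_le_tsum_norm hgs.norm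
      _ ≤ ∑' n, h (n + (N + 1)) / Real.log N := Summable.tsum_le_tsum hle hgs.norm (hhs.div_const _)
      _ = (∑' n, h (n + (N + 1))) / Real.log N := tsum_div_const
      _ ≤ (∑' n, h n) / Real.log N := by
          refine div_le_div_of_nonneg_right ?_ hlogN.le
          have := hh_sum.sum_add_tsum_nat_add (N + 1)
          have h0 : 0 ≤ ∑ i ∈ Finset.range (N + 1), h i := Finset.sum_nonneg fun i _ ↦ hh0 i
          linarith
  calc ‖primeSum ψ N / ((N : ℂ) + 1) - ∑' n, g (n + (N + 1))‖
      ≤ ‖primeSum ψ N / ((N : ℂ) + 1)‖ + ‖∑' n, g (n + (N + 1))‖ := norm_sub_le _ _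
    _ ≤ 8 / 3 * A / Real.log N + (∑' n, h n) / Real.log N := add_le_add h1 h2
    _ = (8 / 3 * A + ∑' n, h n) / Real.log N := by ring

omit χ in
/-- `Nat.sqrt ⌊u⌋ = ⌊√u⌋` for `u ≥ 0`. [folklore] -/
private theorem nat_sqrt_floor_eq {u : ℝ} (hu : 0 ≤ u) : Nat.sqrt ⌊u⌋₊ = ⌊Real.sqrt u⌋₊ := by
  have key : ∀ m : ℕ, m ≤ Nat.sqrt ⌊u⌋₊ ↔ m ≤ ⌊Real.sqrt u⌋₊ := by
    intro m
    rw [Nat.le_sqrt, Nat.le_floor_iff hu, Nat.le_floor_iff (Real.sqrt_nonneg _),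
      Real.le_sqrt (Nat.cast_nonneg _) hu, Nat.cast_mul, sq]
  exact le_antisymm ((key _).1 le_rfl) ((key _).2 le_rfl)

/-- The `log log` density of the prime-square part: `½` if `χ² = χ₀`, else `0`. [folklore] -/
def halfDelta : ℂ := if χ ^ 2 = 1 then 1 / 2 else 0

omit [NeZero q] in
/-- `Σ_{n ≤ ⌊u⌋} sqCoeff(n) = ½ Σ_{p ≤ ⌊√u⌋} χ²(p)/p`. [folklore] -/
private theorem sum_sqCoeff_eq_half (u : ℝ) (hu : 0 ≤ u) :
    ∑ n ∈ Finset.Icc 1 ⌊u⌋₊, sqCoeff χ n =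
      (1 / 2 : ℂ) * ∑ p ∈ (Finset.Icc 1 ⌊Real.sqrt u⌋₊).filter Nat.Prime, (χ ^ 2) (p : ZMod q) / (p : ℂ) := by
  rw [sum_sqCoeff, nat_sqrt_floor_eq hu, Finset.mul_sum]
  refine Finset.sum_congr rfl fun p _ ↦ ?_
  rw [MulChar.pow_apply' χ two_ne_zero]
  ring

/-- **The prime-square part, pointwise**: assuming GRH for `χ²` when `χ² ≠ χ₀`, there are `β`, `K`, `u₀ ≥ 2` with
`‖Σ_{n ≤ u} sqCoeff χ n − δ_χ log log u − β‖ ≤ K/log u` for `u ≥ u₀` (`δ_χ = ½[χ² = χ₀]`; Mertens II for `χ²` at `√u`).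
[cite: Hayani2025, Thm 1.3 (proof: «the following form of Mertens' theorem `Σ_{p ≤ x} χ(p²)/p = ⟨χ,r⟩ log log x + c + O(1/log x)`»)] -/
theorem sqPart_pointwise (hGRH2 : χ ^ 2 ≠ 1 → (χ ^ 2).RiemannHypothesis) :
    ∃ β : ℂ, ∃ K u₀ : ℝ, 2 ≤ u₀ ∧ ∀ u : ℝ, u₀ ≤ u →
      ‖∑ n ∈ Finset.Icc 1 ⌊u⌋₊, sqCoeff χ n - halfDelta χ * (Real.log (Real.log u) : ℂ) - β‖ ≤ K / Real.log u := by
  have hl2 : 0 < Real.log 2 := Real.log_pos (by norm_num)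
  by_cases hψ : χ ^ 2 = 1
  · -- principal `χ²`: Mertens II from the tree at `y = √u`
    set c : ℝ := Mertens.meisselMertens - ∑ p ∈ q.primeFactors, (p : ℝ)⁻¹ with hc
    refine ⟨(1 / 2 : ℂ) * ((c - Real.log 2 : ℝ) : ℂ), 8, max 4 ((q : ℝ) ^ 2), le_max_of_le_left (by norm_num),
      fun u hu ↦ ?_⟩
    have hu4 : 4 ≤ u := le_trans (le_max_left _ _) hu
    have huq : (q : ℝ) ^ 2 ≤ u := le_trans (le_max_right _ _) hu
    have hu0 : 0 ≤ u := by linarith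
    have hsu2 : 2 ≤ Real.sqrt u := by
      rw [show (2 : ℝ) = Real.sqrt (2 ^ 2) by rw [Real.sqrt_sq (by norm_num)]]
      exact Real.sqrt_le_sqrt (by linarith)
    have hsq : (q : ℝ) ≤ Real.sqrt u := by
      rw [show (q : ℝ) = Real.sqrt ((q : ℝ) ^ 2) by rw [Real.sqrt_sq (Nat.cast_nonneg _)]]
      exact Real.sqrt_le_sqrt huq
    have hlogu : 0 < Real.log u := Real.log_pos (by linarith)
    have hlogsu : Real.log (Real.sqrt u) = Real.log u / 2 := Real.log_sqrt hu0
    have hll : Real.log (Real.log (Real.sqrt u)) = Real.log (Real.log u) - Real.log 2 := by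
      rw [hlogsu, Real.log_div hlogu.ne' two_ne_zero]
    have h := norm_sum_principal_div_prime_sub_le (q := q) hsu2 hsq
    rw [hll, hlogsu, ← hc] at h
    rw [sum_sqCoeff_eq_half χ u hu0, halfDelta, if_pos hψ, hψ]
    have e : (1 / 2 : ℂ) * ∑ p ∈ (Finset.Icc 1 ⌊Real.sqrt u⌋₊).filter Nat.Prime,
          (1 : DirichletCharacter ℂ q) (p : ZMod q) / (p : ℂ) -
        1 / 2 * (Real.log (Real.log u) : ℂ) - 1 / 2 * ((c - Real.log 2 : ℝ) : ℂ) =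
        (1 / 2 : ℂ) * (∑ p ∈ (Finset.Icc 1 ⌊Real.sqrt u⌋₊).filter Nat.Prime,
          (1 : DirichletCharacter ℂ q) (p : ZMod q) / (p : ℂ) -
          ((Real.log (Real.log u) - Real.log 2 : ℝ) : ℂ) - (c : ℂ)) := by
      push_cast; ring
    rw [e, norm_mul]
    calc ‖(1 / 2 : ℂ)‖ * _ ≤ (1 / 2) * (8 / (Real.log u / 2)) := by
          rw [show ‖(1 / 2 : ℂ)‖ = 1 / 2 by norm_num]
          exact mul_le_mul_of_nonneg_left h (by norm_num)
      _ = 8 / Real.log u := by field_simp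
  · -- non-principal `χ²`: Mertens II under GRH(χ²)
    obtain ⟨Bψ, K, hK0, hK⟩ := exists_norm_sum_char_div_prime_sub_le (χ ^ 2) hψ (hGRH2 hψ)
    refine ⟨(1 / 2 : ℂ) * Bψ, 2 * K, 16, by norm_num, fun u hu ↦ ?_⟩
    have hu0 : 0 ≤ u := by linarith
    have hlogu : 0 < Real.log u := Real.log_pos (by linarith)
    -- `M = ⌊√u⌋ ≥ 4` and `log M ≥ (log u)/4`
    have hsu4 : 4 ≤ Real.sqrt u := by
      rw [show (4 : ℝ) = Real.sqrt (4 ^ 2) by rw [Real.sqrt_sq (by norm_num)]]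
      exact Real.sqrt_le_sqrt (by linarith)
    set M := ⌊Real.sqrt u⌋₊ with hM
    have hM4 : 4 ≤ M := by rw [hM]; exact Nat.le_floor (by exact_mod_cast hsu4)
    have hM2 : 2 ≤ M := le_trans (by norm_num) hM4
    have hMr : Real.sqrt u / 2 ≤ (M : ℝ) := by
      have := Nat.lt_floor_add_one (Real.sqrt u)
      rw [← hM] at this
      linarith
    have hlogM : Real.log u / 4 ≤ Real.log M := by
      have h1 : Real.log (Real.sqrt u / 2) ≤ Real.log M := Real.log_le_log (by linarith) hMr
      rw [Real.log_div (by linarith) two_ne_zero, Real.log_sqrt hu0] at h1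
      have h16 : Real.log 16 ≤ Real.log u := Real.log_le_log (by norm_num) hu
      rw [show (16 : ℝ) = 2 ^ 4 by norm_num, Real.log_pow] at h16
      push_cast at h16
      linarith
    have hlogM0 : 0 < Real.log M := by linarith
    have h := hK M hM2
    rw [sum_sqCoeff_eq_half χ u hu0, halfDelta, if_neg hψ, zero_mul, sub_zero, ← hM, ← mul_sub, norm_mul,
      show ‖(1 / 2 : ℂ)‖ = 1 / 2 by norm_num]
    calc 1 / 2 * ‖∑ p ∈ (Finset.Icc 1 M).filter Nat.Prime, (χ ^ 2) (p : ZMod q) / (p : ℂ) - Bψ‖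
        ≤ 1 / 2 * (K / Real.log M) := mul_le_mul_of_nonneg_left h (by norm_num)
      _ ≤ 1 / 2 * (K / (Real.log u / 4)) := by
          gcongr
      _ = 2 * K / Real.log u := by field_simp; ring

end Mertens

/-! ## §6 The GRH Riesz bound for EVERY non-principal character (order-`m` and imprimitive cases unified) -/

section RieszBound

variable [NeZero q]

open HalfLineRiesz HalfLineRieszImprimitive in
/-- **GRH ⟹ `‖f_χ(x) + c₀ log x + (m_χ/2) log²x‖ ≤ B` for `x > 1`, for every `χ ≠ χ₀` mod `q`** (`m_χ` = the order of
`L(s, χ)` at `½`): the tree's primitive cases (`exists_norm_halfLineSum_add_le_of_GRH'` when `L(½,χ) ≠ 0`,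
`exists_norm_halfLineSum_add_le_of_GRH_of_zero` for primitive `χ`) extended to imprimitive `χ` with `L(½, χ) = 0` by
the prime powers `p^k`, `p ∣ q` (`halfLineSum_eq_sub`, `norm_inner_sub_le`). GRH-CONDITIONAL.
[cite: Suzuki2025Chebyshev, §4.1 Thm 8 (proof, (4.5)/(4.5'))] -/
theorem exists_norm_halfLineSum_add_le_of_GRH_all (hχ : χ ≠ 1) (hGRH : χ.RiemannHypothesis) :
    ∃ c₀ : ℂ, ∃ B : ℝ, ∀ x : ℝ, 1 < x →
      ‖halfLineSum χ x + (Real.log x : ℂ) * c₀ +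
        (DirichletDisc.zeroOrder χ (1 / 2) : ℂ) * (((Real.log x) ^ 2 / 2 : ℝ) : ℂ)‖ ≤ B := by
  by_cases hhalf : χ.LFunction (1 / 2) = 0
  · -- order `m ≥ 1`: reduce to the primitive character
    haveI : NeZero χ.conductor := ⟨χ.conductor_ne_zero⟩
    have hN1 : 1 < χ.conductor := by
      have h1 : χ.conductor ≠ 1 := fun h ↦ hχ (DirichletCharacter.eq_one_iff_conductor_eq_one.2 h)
      have h0 : χ.conductor ≠ 0 := χ.conductor_ne_zero
      omega
    set ψ := χ.primitiveCharacter with hψdef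
    have hprim : ψ.IsPrimitive := DirichletCharacter.primitiveCharacter_isPrimitive χ
    have hψGRH : ψ.RiemannHypothesis := (DirichletCharacter.riemannHypothesis_iff_primitiveCharacter_holds χ).1 hGRH
    have hψhalf : ψ.LFunction (1 / 2) = 0 :=
      (χ.LFunction_eq_zero_iff_primitiveCharacter (s := 1 / 2) (by norm_num) (by norm_num)).1 hhalf
    have hm : DirichletDisc.zeroOrder χ (1 / 2) = DirichletDisc.zeroOrder ψ (1 / 2) :=
      SuzukiThm8Limits.zeroOrder_eq_primitiveCharacter χ hχ
    obtain ⟨c₀, B₀, hB₀⟩ := HalfLineRiesz.exists_norm_halfLineSum_add_le_of_GRH_of_zero hprim hN1 hψhalf hψGRH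
    set C : ℝ := ∑ p ∈ q.primeFactors, (8 * Real.log p + 12 * Real.log p ^ 2) with hC
    set L : ℂ := ∑ p ∈ q.primeFactors, Real.log p * HalfLineRieszImprimitive.eulerRatio ψ p /
      (1 - HalfLineRieszImprimitive.eulerRatio ψ p) with hL
    refine ⟨c₀ + L, B₀ + C, fun x hx ↦ ?_⟩
    have hx0 : 0 < x := by linarith
    have hsplit : halfLineSum χ x + (Real.log x : ℂ) * (c₀ + L) +
        (DirichletDisc.zeroOrder χ (1 / 2) : ℂ) * (((Real.log x) ^ 2 / 2 : ℝ) : ℂ) =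
        (halfLineSum ψ x + (Real.log x : ℂ) * c₀ +
          (DirichletDisc.zeroOrder ψ (1 / 2) : ℂ) * (((Real.log x) ^ 2 / 2 : ℝ) : ℂ)) -
        ∑ p ∈ q.primeFactors,
          (∑ k ∈ Finset.Icc 1 (Nat.log p ⌊x⌋₊),
              (Real.log p : ℂ) * HalfLineRieszImprimitive.eulerRatio ψ p ^ k *
                ((Real.log x - k * Real.log p : ℝ) : ℂ) -
            (Real.log x : ℂ) * (Real.log p * HalfLineRieszImprimitive.eulerRatio ψ p /
              (1 - HalfLineRieszImprimitive.eulerRatio ψ p))) := by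
      rw [HalfLineRieszImprimitive.halfLineSum_eq_sub χ x, HalfLineRieszImprimitive.sum_not_coprime_eq ψ hx0,
        hm, hL, Finset.sum_sub_distrib, mul_add, Finset.mul_sum]
      ring
    rw [hsplit]
    calc ‖(halfLineSum ψ x + (Real.log x : ℂ) * c₀ +
          (DirichletDisc.zeroOrder ψ (1 / 2) : ℂ) * (((Real.log x) ^ 2 / 2 : ℝ) : ℂ)) -
        ∑ p ∈ q.primeFactors,
          (∑ k ∈ Finset.Icc 1 (Nat.log p ⌊x⌋₊),
              (Real.log p : ℂ) * HalfLineRieszImprimitive.eulerRatio ψ p ^ k *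
                ((Real.log x - k * Real.log p : ℝ) : ℂ) -
            (Real.log x : ℂ) * (Real.log p * HalfLineRieszImprimitive.eulerRatio ψ p /
              (1 - HalfLineRieszImprimitive.eulerRatio ψ p)))‖
        ≤ ‖halfLineSum ψ x + (Real.log x : ℂ) * c₀ +
            (DirichletDisc.zeroOrder ψ (1 / 2) : ℂ) * (((Real.log x) ^ 2 / 2 : ℝ) : ℂ)‖ +
          ‖∑ p ∈ q.primeFactors,
            (∑ k ∈ Finset.Icc 1 (Nat.log p ⌊x⌋₊),
                (Real.log p : ℂ) * HalfLineRieszImprimitive.eulerRatio ψ p ^ k *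
                  ((Real.log x - k * Real.log p : ℝ) : ℂ) -
              (Real.log x : ℂ) * (Real.log p * HalfLineRieszImprimitive.eulerRatio ψ p /
                (1 - HalfLineRieszImprimitive.eulerRatio ψ p)))‖ := norm_sub_le _ _
      _ ≤ B₀ + C := by
          gcongr
          · exact hB₀ x hx
          · rw [hC]
            exact le_trans (norm_sum_le _ _) (Finset.sum_le_sum fun p hp ↦
              HalfLineRieszImprimitive.norm_inner_sub_le ψ (Nat.prime_of_mem_primeFactors hp) hx.le)
  · -- `L(½, χ) ≠ 0`: `m = 0`, the tree's imprimitive bound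
    have hm0 : DirichletDisc.zeroOrder χ (1 / 2) = 0 := by
      by_contra hne
      exact hhalf ((DirichletDisc.zeroOrder_pos_iff χ hχ _).1 (Nat.pos_of_ne_zero hne))
    obtain ⟨B, hB⟩ := HalfLineRieszImprimitive.exists_norm_halfLineSum_add_le_of_GRH' χ hχ hhalf hGRH
    refine ⟨deriv χ.LFunction (1 / 2) / χ.LFunction (1 / 2), B, fun x hx ↦ ?_⟩
    rw [hm0, Nat.cast_zero, zero_mul, add_zero]
    exact hB x hx

end RieszBound


end Hayani2025Mean

end Literature.NumberTheory.LFunctions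

end
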